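import Mathlib.Algebra.MvPolynomial.PDeriv
import Mathlib.Algebra.MvPolynomial.CommRing
import Mathlib.RingTheory.Ideal.Operations
import HarnessLib

/-!
# First-order Taylor expansion modulo the square of an ideal (instrument for the `W(f)` toy model — NOT a resolution theorem)

Engine 1 of the RESOLUTION OBSERVATORY toy model `W(f)` (weighted-centre invariant in characteristic `p`) runs two
"adic" inductions on a substitution `X` fixing the class equation `g`: on the `σ`-adic order (THEOREM I-RIGID T85 with
the hypothesis (noW≤s) of CARVER-NOTES-eng1-g42 §1 F1: "`X ≡ id` on the `W`-slots mod `σ^{s+1}`") and on the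
`(ε_Z)`-adic order (THEOREM RZ / T92 for an arbitrary pointwise-fixed set `Z′` of light slots, CARVER-NOTES-eng1-g42 §3 (i):
"`X` is `Z`-infinitesimal, `X ≡ id mod (ε_Z)`").  The inductive step of both is the same piece of generic algebra: if
`X : x_i ↦ x_i + N_i` with every `N_i` in an ideal `J` (`J = (σ^{s})`, resp. `J = (ε_Z)^r`), then

  `g(x + N) ≡ g(x) + Σ_i N_i · (∂g/∂x_i)(x)   (mod J²)`,

so `g(x + N) = g(x)` forces the LOWEST LAYER identity `Σ_i N_i ∂_i g ∈ J²` (`⊆ (ε_Z)^{2r} ⊆ (ε_Z)^{r+1}`): the lowest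
layer of `N` is a vector field killing `g` to that order — which the pins / LEMMA S / the monomial curve then force to
vanish, and the induction climbs.  (`WeightedCentreLowestTaylor` types the `σ`-adic lowest layer through Taylor
coefficients of a ring endomorphism of `A₀[σ]`; the present file is the ideal-theoretic form, usable for `(ε_Z)`-adic and
mixed filtrations, and for substitutions with values in any commutative algebra.)

Contents (ours, bookkeeping; Mathlib has the one-variable `Polynomial.aeval_add_of_sq_eq_zero` only):

* `aeval_add_sub_aeval_mem` — `g(x + N) - g(x) ∈ J`;
* `aeval_add_sub_sub_sum_mem_sq` — `g(x + N) - g(x) - Σ_i N_i · (∂_i g)(x) ∈ J²`;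
* `sum_mul_aeval_pderiv_mem_sq_of_aeval_eq` — if `g(x + N) = g(x)` then `Σ_i N_i (∂_i g)(x) ∈ J²`;
* the self-substitution specialisations (`x = X`): `aeval_X_add_sub_sub_sum_mem_sq`,
  `sum_mul_pderiv_mem_sq_of_aeval_eq`, `sum_mul_pderiv_mem_pow_of_aeval_eq` (`J = I^r`, conclusion in `I^{2r}`).

VALUE: bookkeeping for a toy model (Resolution Observatory cell `pub-rosobs`, carver lane gen 62; AI-written Lean; AI
review is weaker than expert review); NOT a statement about the invariant of [AbramovichTemkinWlodarczyk2024] and NOT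
progress on the summit.  Reference frame (partial derivatives and Taylor's formula for polynomials): [Lang2002, Ch. IV §1].
-/

namespace Literature.AlgebraicGeometry.Resolution.WeightedBlowup

namespace IdealTaylor

open MvPolynomial

variable {R : Type*} [CommRing R] {σ : Type*} {A : Type*} [CommRing A] [Algebra R A]

/-- (ours, bookkeeping) **Zeroth order.** If every `N_i ∈ J`, then `g(x + N) - g(x) ∈ J`. [cite: Lang2002, Ch. IV §1] -/
theorem aeval_add_sub_aeval_mem (J : Ideal A) (x N : σ → A) (hN : ∀ i, N i ∈ J) (g : MvPolynomial σ R) :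
    aeval (fun i => x i + N i) g - aeval x g ∈ J := by
  induction g using MvPolynomial.induction_on with
  | C a => simp
  | add p q hp hq =>
    have e : aeval (fun i => x i + N i) (p + q) - aeval x (p + q)
        = (aeval (fun i => x i + N i) p - aeval x p) + (aeval (fun i => x i + N i) q - aeval x q) := by
      rw [map_add, map_add]; ring
    rw [e]
    exact J.add_mem hp hq
  | mul_X p i hp =>
    have e : aeval (fun i => x i + N i) (p * X i) - aeval x (p * X i)
        = (aeval (fun i => x i + N i) p - aeval x p) * (x i + N i) + aeval x p * N i := by
      rw [map_mul, map_mul, aeval_X, aeval_X]; ring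
    rw [e]
    exact J.add_mem (J.mul_mem_right _ hp) (J.mul_mem_left _ (hN i))

/-- (ours, bookkeeping) The derivative sum of a product with a variable:
`Σ_j N_j (∂_j (p·X_i))(x) = (Σ_j N_j (∂_j p)(x))·x_i + N_i·p(x)`. [cite: Lang2002, Ch. IV §1] -/
theorem sum_mul_aeval_pderiv_mul_X [Fintype σ] (x N : σ → A) (p : MvPolynomial σ R) (i : σ) :
    ∑ j, N j * aeval x (pderiv j (p * X i)) = (∑ j, N j * aeval x (pderiv j p)) * x i + N i * aeval x p := by
  classical
  simp only [pderiv_mul, map_add, map_mul, aeval_X, mul_add, Finset.sum_add_distrib, Finset.sum_mul]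
  congr 1
  · exact Finset.sum_congr rfl fun j _ => by ring
  · rw [Finset.sum_eq_single i (fun j _ hji => by rw [pderiv_X_of_ne (Ne.symm hji), map_zero, mul_zero, mul_zero])
      (fun h => absurd (Finset.mem_univ i) h)]
    rw [pderiv_X_self, map_one, mul_one]

/-- (ours, bookkeeping) **First-order Taylor expansion modulo `J²`.** If every `N_i ∈ J`, then
`g(x + N) - g(x) - Σ_i N_i · (∂g/∂x_i)(x) ∈ J²`. [cite: Lang2002, Ch. IV §1] -/
theorem aeval_add_sub_sub_sum_mem_sq [Fintype σ] (J : Ideal A) (x N : σ → A) (hN : ∀ i, N i ∈ J)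
    (g : MvPolynomial σ R) :
    aeval (fun i => x i + N i) g - aeval x g - ∑ i, N i * aeval x (pderiv i g) ∈ J ^ 2 := by
  induction g using MvPolynomial.induction_on with
  | C a => simp
  | add p q hp hq =>
    have e : aeval (fun i => x i + N i) (p + q) - aeval x (p + q) - ∑ i, N i * aeval x (pderiv i (p + q))
        = (aeval (fun i => x i + N i) p - aeval x p - ∑ i, N i * aeval x (pderiv i p))
          + (aeval (fun i => x i + N i) q - aeval x q - ∑ i, N i * aeval x (pderiv i q)) := by
      simp only [map_add, mul_add, Finset.sum_add_distrib]; ring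
    rw [e]
    exact (J ^ 2).add_mem hp hq
  | mul_X p i hp =>
    rw [sum_mul_aeval_pderiv_mul_X]
    have e : aeval (fun i => x i + N i) (p * X i) - aeval x (p * X i)
          - ((∑ j, N j * aeval x (pderiv j p)) * x i + N i * aeval x p)
        = (aeval (fun i => x i + N i) p - aeval x p - ∑ j, N j * aeval x (pderiv j p)) * (x i + N i)
          + (∑ j, N j * aeval x (pderiv j p)) * N i := by
      rw [map_mul, map_mul, aeval_X, aeval_X]; ring
    rw [e]
    refine (J ^ 2).add_mem ((J ^ 2).mul_mem_right _ hp) ?_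
    rw [pow_two]
    exact Ideal.mul_mem_mul (J.sum_mem fun j _ => J.mul_mem_right _ (hN j)) (hN i)

/-- (ours, bookkeeping) **Lowest-layer identity.** If every `N_i ∈ J` and the substitution FIXES `g` at `x`
(`g(x + N) = g(x)`), then `Σ_i N_i · (∂g/∂x_i)(x) ∈ J²`. [cite: Lang2002, Ch. IV §1] -/
theorem sum_mul_aeval_pderiv_mem_sq_of_aeval_eq [Fintype σ] (J : Ideal A) (x N : σ → A) (hN : ∀ i, N i ∈ J)
    {g : MvPolynomial σ R} (hg : aeval (fun i => x i + N i) g = aeval x g) :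
    ∑ i, N i * aeval x (pderiv i g) ∈ J ^ 2 := by
  have h := aeval_add_sub_sub_sum_mem_sq J x N hN g
  rw [hg, sub_self, zero_sub] at h
  exact (Submodule.neg_mem_iff _).mp h

section Self

variable [Fintype σ]

/-- (ours, bookkeeping) Self-substitution form (`x = X`): `g(X + N) - g - Σ_i N_i ∂_i g ∈ J²` for `N_i ∈ J`,
an ideal of the polynomial ring itself. [cite: Lang2002, Ch. IV §1] -/
theorem aeval_X_add_sub_sub_sum_mem_sq (J : Ideal (MvPolynomial σ R)) (N : σ → MvPolynomial σ R)
    (hN : ∀ i, N i ∈ J) (g : MvPolynomial σ R) :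
    aeval (fun i => X i + N i) g - g - ∑ i, N i * pderiv i g ∈ J ^ 2 := by
  have h := aeval_add_sub_sub_sum_mem_sq J X N hN g
  simpa only [aeval_X_left, AlgHom.id_apply] using h

/-- (ours, bookkeeping) Self-substitution, isotropy form: `g(X + N) = g` with `N_i ∈ J` gives `Σ_i N_i ∂_i g ∈ J²`.
[cite: Lang2002, Ch. IV §1] -/
theorem sum_mul_pderiv_mem_sq_of_aeval_eq (J : Ideal (MvPolynomial σ R)) (N : σ → MvPolynomial σ R)
    (hN : ∀ i, N i ∈ J) {g : MvPolynomial σ R} (hg : aeval (fun i => X i + N i) g = g) :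
    ∑ i, N i * pderiv i g ∈ J ^ 2 := by
  have h := sum_mul_aeval_pderiv_mem_sq_of_aeval_eq J X N hN (g := g)
    (by simpa only [aeval_X_left, AlgHom.id_apply] using hg)
  simpa only [aeval_X_left, AlgHom.id_apply] using h

/-- (ours, bookkeeping) The adic inductive step: `N_i ∈ I^r` and `g(X + N) = g` give `Σ_i N_i ∂_i g ∈ I^{2r}`
(`⊆ I^{r+1}` as soon as `r ≥ 1`). [cite: Lang2002, Ch. IV §1] -/
theorem sum_mul_pderiv_mem_pow_of_aeval_eq (I : Ideal (MvPolynomial σ R)) (r : ℕ) (N : σ → MvPolynomial σ R)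
    (hN : ∀ i, N i ∈ I ^ r) {g : MvPolynomial σ R} (hg : aeval (fun i => X i + N i) g = g) :
    ∑ i, N i * pderiv i g ∈ I ^ (2 * r) := by
  have h := sum_mul_pderiv_mem_sq_of_aeval_eq (I ^ r) N hN hg
  rwa [← pow_mul, mul_comm] at h

/-- (ours, bookkeeping) … and hence `∈ I^{r+1}` for `1 ≤ r`. [cite: Lang2002, Ch. IV §1] -/
theorem sum_mul_pderiv_mem_pow_succ_of_aeval_eq (I : Ideal (MvPolynomial σ R)) {r : ℕ} (hr : 1 ≤ r)
    (N : σ → MvPolynomial σ R) (hN : ∀ i, N i ∈ I ^ r) {g : MvPolynomial σ R}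
    (hg : aeval (fun i => X i + N i) g = g) : ∑ i, N i * pderiv i g ∈ I ^ (r + 1) :=
  Ideal.pow_le_pow_right (by omega) (sum_mul_pderiv_mem_pow_of_aeval_eq I r N hN hg)

end Self

/-! ## Smoke test -/

section Smoke

/-- Smoke test (ours): the statement instantiates (one variable over `ℤ`, `J = ⊤`). -/
example (N : Fin 1 → MvPolynomial (Fin 1) ℤ) (g : MvPolynomial (Fin 1) ℤ) :
    aeval (fun i => X i + N i) g - g - ∑ i, N i * pderiv i g ∈ (⊤ : Ideal (MvPolynomial (Fin 1) ℤ)) ^ 2 :=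
  aeval_X_add_sub_sub_sum_mem_sq ⊤ N (fun _ => Submodule.mem_top) g

end Smoke

end IdealTaylor

end Literature.AlgebraicGeometry.Resolution.WeightedBlowup
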